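import Literature.Probability.NegativeDependence.NegativeAssociationEvents
import HarnessLib

/-!
# NA is closed under independent products; the Zero–One Lemma (Dubhashi–Ranjan, Prop. 7 (1) and Lemma 8)

D. Dubhashi, D. Ranjan, *Balls and bins: a study in negative dependence*, Random Struct. Algorithms 13 (1998)
99–124 (held `paper:doi-10-1002-sici-1098-2418-199809-13-2-99-aid-rsa1-3-0-co-2-m`). Verbatim (pp. 5–6):

> **Definition 1 (Negative Association)** […] (−A) The random variables `X` are negatively associated if for every
> two disjoint index sets `I, J ⊆ [n]`, `E[f(X_i, i ∈ I) g(X_j, j ∈ J)] ≤ E[f(X_i, i ∈ I)] E[g(X_j, j ∈ J)]` for all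
> functions `f : ℝ^{|I|} → ℝ` and `g : ℝ^{|J|} → ℝ` that are both non-decreasing or both non-increasing.
> Finally, the following proposition lists two simple but extremely useful properties of negative association [13]:
> **Proposition 7** 1. If `X` and `Y` satisfy (−A) and are mutually independent, then the augmented vector
> `(X, Y) = (X_1, ⋯, X_n, Y_1, ⋯, Y_m)` satisfies (−A). 2. […] non-decreasing (or non-increasing) functions of
> disjoint subsets of negatively associated variables are also negatively associated.
> **Lemma 8 (Zero–One Lemma for (−A))** If `X_1, …, X_n` are zero-one random variables such that `Σ_i X_i = 1`,
> then `X_1, …, X_n` satisfy (−A).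

([13] = K. Joag-Dev, F. Proschan, *Negative association of random variables with applications*, Ann. Statist. 11
(1983), Property P7.) R. Pemantle [Pemantle2000, §2.1]: "3. Products. If `μ_1` and `μ_2` are negatively dependent,
then clearly `μ_1 × μ_2` should be."

## What is here (0/1 variables; unnormalized nonnegative weights, the tree's `IsNegAssoc` / `IsCNA` / `IsCNAPlus`)

* §1 the **product weight** `prodWeight μ ν` on `2^{σ ⊔ τ}` (`(μ × ν)(S ⊔ T) = μ(S) ν(T)`: the law of the
  augmented vector of two independent families) and its calculus: expectations as iterated sums
  (`ex_prodWeight`), mass, and commutation with conditioning, external fields and projections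
  (`pin_prodWeight`, `extField_prodWeight`, `projectOn_prodWeight`).
* §2 **Proposition 7 (1)**: `IsNegAssoc.prod` — the printed two-step argument (condition on the `σ`-coordinates:
  the sections `T ↦ F(S ⊔ T)` are increasing and depend on the `τ`-parts of the coordinate sets, so NA of `ν`
  applies; the resulting `S ↦ E_ν F(S ⊔ ·)` are increasing and depend on the `σ`-parts, so NA of `μ` applies);
  with §1, **`IsCNA.prod`** and **`IsCNAPlus.prod`**.
* §3 **Lemma 8 (Zero–One Lemma)**, in the slightly more general "at most one `X_i = 1`" form which is stable under
  projections: a nonnegative weight supported on sets of cardinality `≤ 1` is NA (`isNegAssoc_of_card_le_one`, via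
  the event form of NA, `isNegAssoc_of_events`: two increasing events on disjoint coordinates cannot both contain
  the same singleton unless one of them is trivial), indeed CNA+ (`isCNAPlus_of_card_le_one`).

Not treated: Proposition 7 (2) (monotone images leave the 0/1 setting) and the balls-and-bins vector (Prop. 11).

## References

* [DubhashiRanjan1998] D. Dubhashi, D. Ranjan, Balls and bins: a study in negative dependence, Random Struct.
  Algorithms 13 (1998) — §2.1 Def. 1, Prop. 7; §2.2 Lemma 8.
* [JoagDevProschan1983] K. Joag-Dev, F. Proschan, Negative association of random variables with applications,
  Ann. Statist. 11 (1983) — Property P7 (the source of Prop. 7).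
* [Pemantle2000] R. Pemantle, Towards a theory of negative dependence, J. Math. Phys. 41 (2000) — §2.1 (3)
  (products), §2.2 Defs. 2.1–2.2.
* [BorceaBrandenLiggett2007] J. Borcea, P. Brändén, T. M. Liggett — §2.1 Def. 2.7 (NA, CNA, CNA+).
-/

noncomputable section

open Finset
open Literature.Combinatorics.Sahi2008
open Literature.Combinatorics.StablePolynomials

universe u

namespace Literature.Probability.NegativeDependence

variable {σ τ : Type u} [Fintype σ] [DecidableEq σ] [Fintype τ] [DecidableEq τ]

/-! ## §1 The product weight -/

section Product

omit [Fintype σ] [DecidableEq σ] [Fintype τ] [DecidableEq τ] in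
/-- **Product weight** of `μ` on `2^σ` and `ν` on `2^τ`: the weight `U ↦ μ(U ∩ σ) ν(U ∩ τ)` on `2^{σ ⊔ τ}` — the
(unnormalized) joint law of two independent families of 0/1 variables ("`X` and `Y` […] mutually independent,
[…] the augmented vector `(X, Y)`"). [cite: DubhashiRanjan1998, §2.1 Prop. 7 (1); Pemantle2000, §2.1 (3)] -/
def prodWeight (μ : Finset σ → ℝ) (ν : Finset τ → ℝ) : Finset (σ ⊕ τ) → ℝ := fun U => μ U.toLeft * ν U.toRight

omit [Fintype σ] [DecidableEq σ] [Fintype τ] [DecidableEq τ] in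
/-- Unfolding `prodWeight`. [cite: DubhashiRanjan1998, §2.1 Prop. 7 (1)] -/
theorem prodWeight_apply (μ : Finset σ → ℝ) (ν : Finset τ → ℝ) (U : Finset (σ ⊕ τ)) :
    prodWeight μ ν U = μ U.toLeft * ν U.toRight := rfl

omit [Fintype σ] [DecidableEq σ] [Fintype τ] [DecidableEq τ] in
/-- `(μ × ν)(S ⊔ T) = μ(S) ν(T)`. [cite: DubhashiRanjan1998, §2.1 Prop. 7 (1)] -/
theorem prodWeight_disjSum (μ : Finset σ → ℝ) (ν : Finset τ → ℝ) (S : Finset σ) (T : Finset τ) :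
    prodWeight μ ν (S.disjSum T) = μ S * ν T := by
  rw [prodWeight_apply, Finset.toLeft_disjSum, Finset.toRight_disjSum]

omit [Fintype σ] [DecidableEq σ] [Fintype τ] [DecidableEq τ] in
/-- Products of nonnegative weights are nonnegative. [cite: DubhashiRanjan1998, §2.1 Prop. 7 (1)] -/
theorem prodWeight_nonneg {μ : Finset σ → ℝ} {ν : Finset τ → ℝ} (hμ : ∀ S, 0 ≤ μ S) (hν : ∀ T, 0 ≤ ν T)
    (U : Finset (σ ⊕ τ)) : 0 ≤ prodWeight μ ν U :=
  mul_nonneg (hμ _) (hν _)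

omit [DecidableEq σ] [DecidableEq τ] in
/-- Sums over `2^{σ ⊔ τ}` as iterated sums over `(S, T)`. [folklore] -/
private theorem sum_finset_sum_eq_sum_sum (f : Finset (σ ⊕ τ) → ℝ) :
    ∑ U, f U = ∑ S : Finset σ, ∑ T : Finset τ, f (S.disjSum T) := by
  rw [← Fintype.sum_prod_type']
  exact Fintype.sum_equiv Finset.sumEquiv.toEquiv _ _ fun U => by
    simp [Finset.sumEquiv, Finset.toLeft_disjSum_toRight]

omit [Fintype σ] [Fintype τ] in
/-- Intersections are computed coordinatewise on `2^{σ ⊔ τ}`. [folklore] -/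
private theorem disjSum_inter (S : Finset σ) (T : Finset τ) (R : Finset (σ ⊕ τ)) :
    S.disjSum T ∩ R = (S ∩ R.toLeft).disjSum (T ∩ R.toRight) := by
  ext x
  cases x with
  | inl a => simp [Finset.inl_mem_disjSum]
  | inr b => simp [Finset.inr_mem_disjSum]

omit [DecidableEq σ] [DecidableEq τ] in
/-- **Expectations under the product weight** as iterated expectations (Fubini): `E_{μ×ν}[H] = Σ_S μ(S) E_ν[H(S ⊔ ·)]`.
[cite: DubhashiRanjan1998, §2.1 Prop. 7 (1)] -/
theorem ex_prodWeight (μ : Finset σ → ℝ) (ν : Finset τ → ℝ) (H : Finset (σ ⊕ τ) → ℝ) :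
    ex (prodWeight μ ν) H = ∑ S : Finset σ, μ S * ex ν (fun T => H (S.disjSum T)) := by
  rw [ex_def, sum_finset_sum_eq_sum_sum]
  refine Finset.sum_congr rfl fun S _ => ?_
  rw [ex_def, Finset.mul_sum]
  exact Finset.sum_congr rfl fun T _ => by rw [prodWeight_disjSum, mul_assoc]

omit [DecidableEq σ] [DecidableEq τ] in
/-- `(μ × ν)(Ω) = μ(Ω) ν(Ω)`. [cite: DubhashiRanjan1998, §2.1 Prop. 7 (1)] -/
theorem mass_prodWeight (μ : Finset σ → ℝ) (ν : Finset τ → ℝ) : mass (prodWeight μ ν) = mass μ * mass ν := by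
  rw [mass_def, sum_finset_sum_eq_sum_sum, mass_def, mass_def, Finset.sum_mul_sum]
  exact Finset.sum_congr rfl fun S _ => Finset.sum_congr rfl fun T _ => prodWeight_disjSum μ ν S T

omit [Fintype σ] [DecidableEq σ] [Fintype τ] [DecidableEq τ] in
/-- Containment and disjointness on `2^{σ ⊔ τ}` are coordinatewise. [folklore] -/
private theorem disjoint_iff_toLeft_toRight (O U : Finset (σ ⊕ τ)) :
    Disjoint O U ↔ Disjoint O.toLeft U.toLeft ∧ Disjoint O.toRight U.toRight := by
  simp only [Finset.disjoint_left, Finset.mem_toLeft, Finset.mem_toRight]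
  constructor
  · intro h
    exact ⟨fun a ha haU => h ha haU, fun b hb hbU => h hb hbU⟩
  · rintro ⟨hl, hr⟩ x hxO hxU
    cases x with
    | inl a => exact hl hxO hxU
    | inr b => exact hr hxO hxU

omit [Fintype σ] [Fintype τ] in
/-- **Conditioning a product** is the product of the conditionings. [cite: Pemantle2000, §2.1 (2), (3);
DubhashiRanjan1998, §2.1 Prop. 7 (1)] -/
theorem pin_prodWeight (I O : Finset (σ ⊕ τ)) (μ : Finset σ → ℝ) (ν : Finset τ → ℝ) :
    pin I O (prodWeight μ ν) = prodWeight (pin I.toLeft O.toLeft μ) (pin I.toRight O.toRight ν) := by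
  funext U
  rw [pin_apply, prodWeight_apply, prodWeight_apply, pin_apply, pin_apply]
  have h1 : I ⊆ U ↔ I.toLeft ⊆ U.toLeft ∧ I.toRight ⊆ U.toRight := by
    conv_lhs => rw [← Finset.toLeft_disjSum_toRight (u := U)]
    exact Finset.subset_disjSum
  have h2 := disjoint_iff_toLeft_toRight O U
  by_cases hA : I ⊆ U ∧ Disjoint O U
  · obtain ⟨hI, hO⟩ := hA
    rw [if_pos ⟨hI, hO⟩, if_pos ⟨(h1.1 hI).1, (h2.1 hO).1⟩, if_pos ⟨(h1.1 hI).2, (h2.1 hO).2⟩]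
  · rw [if_neg hA]
    by_cases hl : I.toLeft ⊆ U.toLeft ∧ Disjoint O.toLeft U.toLeft
    · by_cases hr : I.toRight ⊆ U.toRight ∧ Disjoint O.toRight U.toRight
      · exact absurd ⟨h1.2 ⟨hl.1, hr.1⟩, h2.2 ⟨hl.2, hr.2⟩⟩ hA
      · rw [if_neg hr, mul_zero]
    · rw [if_neg hl, zero_mul]

omit [Fintype σ] [Fintype τ] [DecidableEq σ] [DecidableEq τ] in
/-- **An external field on a product** is the product of the restricted fields. [cite: Pemantle2000, §2.1 (6),
(3); DubhashiRanjan1998, §2.1 Prop. 7 (1)] -/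
theorem extField_prodWeight (a : σ ⊕ τ → ℝ) (μ : Finset σ → ℝ) (ν : Finset τ → ℝ) :
    extField a (prodWeight μ ν) = prodWeight (extField (a ∘ Sum.inl) μ) (extField (a ∘ Sum.inr) ν) := by
  funext U
  rw [extField_apply, prodWeight_apply, prodWeight_apply, extField_apply, extField_apply]
  have hprod : ∏ i ∈ U, a i = (∏ i ∈ U.toLeft, a (Sum.inl i)) * ∏ i ∈ U.toRight, a (Sum.inr i) := by
    conv_lhs => rw [← Finset.toLeft_disjSum_toRight (u := U)]
    exact Finset.prod_disjSum _ _ _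
  rw [hprod]
  simp only [Function.comp_apply]
  ring

/-- **A projection of a product** is the product of the projections. [cite: Pemantle2000, §2.1 (1), (3);
DubhashiRanjan1998, §2.1 Prop. 7 (1)] -/
theorem projectOn_prodWeight (R : Finset (σ ⊕ τ)) (μ : Finset σ → ℝ) (ν : Finset τ → ℝ) :
    projectOn R (prodWeight μ ν) = prodWeight (projectOn R.toLeft μ) (projectOn R.toRight ν) := by
  funext U
  rw [projectOn_apply, prodWeight_apply, projectOn_apply, projectOn_apply, Finset.sum_mul_sum,
    sum_finset_sum_eq_sum_sum]
  refine Finset.sum_congr rfl fun S _ => Finset.sum_congr rfl fun T _ => ?_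
  rw [disjSum_inter, prodWeight_disjSum]
  have hiff : (S ∩ R.toLeft).disjSum (T ∩ R.toRight) = U ↔ S ∩ R.toLeft = U.toLeft ∧ T ∩ R.toRight = U.toRight :=
    Finset.disjSum_eq_iff
  by_cases h1 : S ∩ R.toLeft = U.toLeft
  · by_cases h2 : T ∩ R.toRight = U.toRight
    · rw [if_pos (hiff.2 ⟨h1, h2⟩), if_pos h1, if_pos h2]
    · rw [if_neg (fun h => h2 (hiff.1 h).2), if_neg h2, mul_zero]
  · rw [if_neg (fun h => h1 (hiff.1 h).1), if_neg h1, zero_mul]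

end Product

/-! ## §2 Proposition 7 (1): products of NA weights are NA -/

section NA

omit [Fintype σ] [Fintype τ] [DecidableEq σ] [DecidableEq τ] in
/-- Disjoint coordinate sets have disjoint `σ`- and `τ`-parts. [folklore] -/
private theorem disjoint_toLeft_toRight {E₁ E₂ : Finset (σ ⊕ τ)} (h : Disjoint E₁ E₂) :
    Disjoint E₁.toLeft E₂.toLeft ∧ Disjoint E₁.toRight E₂.toRight :=
  (disjoint_iff_toLeft_toRight E₁ E₂).1 h

omit [Fintype σ] [Fintype τ] in
/-- The sections `T ↦ F(S ⊔ T)` of a function depending on `E` depend on the `τ`-part of `E`, and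
`S ↦ F(S ⊔ T)` on its `σ`-part. [cite: DubhashiRanjan1998, §2.1 Def. 1 (functions of `X_i, i ∈ I`)] -/
theorem DeterminedBy.disjSum_sections {F : Finset (σ ⊕ τ) → ℝ} {E : Finset (σ ⊕ τ)} (hF : DeterminedBy F E) :
    (∀ S : Finset σ, DeterminedBy (fun T : Finset τ => F (S.disjSum T)) E.toRight) ∧
      ∀ T : Finset τ, DeterminedBy (fun S : Finset σ => F (S.disjSum T)) E.toLeft := by
  refine ⟨fun S T T' hTT' => hF _ _ ?_, fun T S S' hSS' => hF _ _ ?_⟩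
  · rw [disjSum_inter, disjSum_inter, hTT']
  · rw [disjSum_inter, disjSum_inter, hSS']

/-- **Dubhashi–Ranjan, Proposition 7 (1) / Joag-Dev–Proschan, Property P7: the union of two independent NA families
is NA.** For nonnegative NA weights `μ` on `2^σ` and `ν` on `2^τ`, the product weight on `2^{σ ⊔ τ}` is NA. Proof:
for increasing `F`, `G` on disjoint coordinate sets, the sections `F(S ⊔ ·)`, `G(S ⊔ ·)` are increasing on
disjoint `τ`-coordinates, so `E_ν[F G](S) ν(Ω) ≤ E_ν[F](S) E_ν[G](S)`; the functions `S ↦ E_ν[F](S)`,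
`S ↦ E_ν[G](S)` are increasing on disjoint `σ`-coordinates, so NA of `μ` finishes.
[cite: DubhashiRanjan1998, §2.1 Prop. 7 (1); JoagDevProschan1983, Property P7; Pemantle2000, §2.1 (3)] -/
theorem IsNegAssoc.prod {μ : Finset σ → ℝ} {ν : Finset τ → ℝ} (hμ : IsNegAssoc μ) (hν : IsNegAssoc ν)
    (hμ0 : ∀ S, 0 ≤ μ S) (hν0 : ∀ T, 0 ≤ ν T) : IsNegAssoc (prodWeight μ ν) := by
  intro F G hF hG E₁ E₂ hFE hGE hdisj
  obtain ⟨hdisjL, hdisjR⟩ := disjoint_toLeft_toRight hdisj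
  -- the sections over a fixed `σ`-configuration
  set FS : Finset σ → Finset τ → ℝ := fun S T => F (S.disjSum T) with hFS
  set GS : Finset σ → Finset τ → ℝ := fun S T => G (S.disjSum T) with hGS
  have hFSm : ∀ S, Monotone (FS S) := fun S T T' h => hF (Finset.disjSum_mono (subset_refl S) h)
  have hGSm : ∀ S, Monotone (GS S) := fun S T T' h => hG (Finset.disjSum_mono (subset_refl S) h)
  have hA : ∀ S, ex ν (FS S * GS S) * mass ν ≤ ex ν (FS S) * ex ν (GS S) := fun S =>
    hν (hFSm S) (hGSm S) (hFE.disjSum_sections.1 S) (hGE.disjSum_sections.1 S) hdisjR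
  -- the partial expectations as functions of the `σ`-configuration
  set f : Finset σ → ℝ := fun S => ex ν (FS S) with hf
  set g : Finset σ → ℝ := fun S => ex ν (GS S) with hg
  have hfm : Monotone f := fun S S' h =>
    Finset.sum_le_sum fun T _ => mul_le_mul_of_nonneg_left (hF (Finset.disjSum_mono h (subset_refl T))) (hν0 T)
  have hgm : Monotone g := fun S S' h =>
    Finset.sum_le_sum fun T _ => mul_le_mul_of_nonneg_left (hG (Finset.disjSum_mono h (subset_refl T))) (hν0 T)
  have hfE : DeterminedBy f E₁.toLeft := fun S S' hSS' => by
    simp only [hf, hFS]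
    exact congrArg (ex ν) (funext fun T => hFE.disjSum_sections.2 T S S' hSS')
  have hgE : DeterminedBy g E₂.toLeft := fun S S' hSS' => by
    simp only [hg, hGS]
    exact congrArg (ex ν) (funext fun T => hGE.disjSum_sections.2 T S S' hSS')
  have hB : ex μ (f * g) * mass μ ≤ ex μ f * ex μ g := hμ hfm hgm hfE hgE hdisjL
  -- assembly
  have e1 : ex (prodWeight μ ν) (F * G) = ∑ S, μ S * ex ν (FS S * GS S) := ex_prodWeight μ ν (F * G)
  have e2 : ex (prodWeight μ ν) F = ex μ f := by rw [ex_prodWeight, ex_def]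
  have e3 : ex (prodWeight μ ν) G = ex μ g := by rw [ex_prodWeight, ex_def]
  calc ex (prodWeight μ ν) (F * G) * mass (prodWeight μ ν)
      = mass μ * ∑ S, μ S * (ex ν (FS S * GS S) * mass ν) := by
        rw [e1, mass_prodWeight, Finset.mul_sum, Finset.sum_mul]
        exact Finset.sum_congr rfl fun S _ => by ring
    _ ≤ mass μ * ∑ S, μ S * (ex ν (FS S) * ex ν (GS S)) :=
        mul_le_mul_of_nonneg_left (Finset.sum_le_sum fun S _ => mul_le_mul_of_nonneg_left (hA S) (hμ0 S))
          (mass_nonneg hμ0)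
    _ = ex μ (f * g) * mass μ := by
        rw [ex_def, mul_comm]
        simp only [Pi.mul_apply, hf, hg]
    _ ≤ ex μ f * ex μ g := hB
    _ = ex (prodWeight μ ν) F * ex (prodWeight μ ν) G := by rw [e2, e3]

/-- **Products of CNA weights are CNA** (conditioning a product = product of conditionings).
[cite: DubhashiRanjan1998, §2.1 Prop. 7 (1); Pemantle2000, §2.1 (2)–(3), §2.2 Def. 2.2] -/
theorem IsCNA.prod {μ : Finset σ → ℝ} {ν : Finset τ → ℝ} (hμ : IsCNA μ) (hν : IsCNA ν)
    (hμ0 : ∀ S, 0 ≤ μ S) (hν0 : ∀ T, 0 ≤ ν T) : IsCNA (prodWeight μ ν) := fun I O => by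
  rw [pin_prodWeight]
  exact (hμ _ _).prod (hν _ _) (pin_nonneg hμ0 _ _) (pin_nonneg hν0 _ _)

/-- **Products of CNA+ weights are CNA+** (fields and projections of a product are products of fields and
projections). [cite: DubhashiRanjan1998, §2.1 Prop. 7 (1); Pemantle2000, §2.1 (1), (3), (6), §2.2 (CNA+)] -/
theorem IsCNAPlus.prod {μ : Finset σ → ℝ} {ν : Finset τ → ℝ} (hμ : IsCNAPlus μ) (hν : IsCNAPlus ν)
    (hμ0 : ∀ S, 0 ≤ μ S) (hν0 : ∀ T, 0 ≤ ν T) : IsCNAPlus (prodWeight μ ν) := fun a ha R => by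
  rw [extField_prodWeight, projectOn_prodWeight]
  exact (hμ (a ∘ Sum.inl) (fun i => ha _) R.toLeft).prod (hν (a ∘ Sum.inr) (fun i => ha _) R.toRight)
    (projectOn_nonneg (extField_nonneg hμ0 fun i => ha _) _)
    (projectOn_nonneg (extField_nonneg hν0 fun i => ha _) _)

end NA

/-! ## §3 Lemma 8: the Zero–One Lemma -/

section ZeroOne

/-- **Dubhashi–Ranjan, Lemma 8 (Zero–One Lemma), "at most one" form**: a nonnegative weight supported on sets of
cardinality `≤ 1` (at most one `X_i = 1`) is NA. Proof via the event form of NA: if increasing events `𝒜`, `ℬ`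
on disjoint coordinate sets both contain a singleton `{e}` but not `∅`, then `e` lies in both coordinate sets.
[cite: DubhashiRanjan1998, §2.2 Lemma 8] -/
theorem isNegAssoc_of_card_le_one {μ : Finset σ → ℝ} (h0 : ∀ S, 0 ≤ μ S) (h1 : ∀ S, μ S ≠ 0 → S.card ≤ 1) :
    IsNegAssoc μ := by
  refine isNegAssoc_of_events fun 𝒜 ℬ h𝒜 hℬ E₁ E₂ h𝒜E hℬE hdisj => ?_
  have hsum0 : ∀ 𝒞 : Finset (Finset σ), 0 ≤ ∑ S ∈ 𝒞, μ S := fun 𝒞 => Finset.sum_nonneg fun S _ => h0 S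
  by_cases hA : ∅ ∈ 𝒜
  · have hAu : 𝒜 = Finset.univ := Finset.eq_univ_of_forall fun S => h𝒜 (Finset.empty_subset S) hA
    rw [hAu, Finset.univ_inter, ← mass_def, mul_comm]
  by_cases hB : ∅ ∈ ℬ
  · have hBu : ℬ = Finset.univ := Finset.eq_univ_of_forall fun S => hℬ (Finset.empty_subset S) hB
    rw [hBu, Finset.inter_univ, ← mass_def]
  have hz : ∑ S ∈ 𝒜 ∩ ℬ, μ S = 0 := by
    refine Finset.sum_eq_zero fun S hS => ?_
    by_contra hne
    obtain ⟨hSA, hSB⟩ := Finset.mem_inter.1 hS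
    have hSne : S ≠ ∅ := fun h => hA (h ▸ hSA)
    have hc : S.card = 1 := le_antisymm (h1 S hne) (Finset.card_pos.2 (Finset.nonempty_of_ne_empty hSne))
    obtain ⟨e, rfl⟩ := Finset.card_eq_one.1 hc
    have key : ∀ (𝒞 : Finset (Finset σ)) (E : Finset σ), DeterminedBy (setInd 𝒞) E → {e} ∈ 𝒞 → ∅ ∉ 𝒞 →
        e ∈ E := by
      intro 𝒞 E h𝒞E heC h0C
      by_contra he
      have h := h𝒞E {e} ∅ (by rw [Finset.empty_inter, Finset.singleton_inter_of_notMem he])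
      rw [setInd_apply, setInd_apply, if_pos heC, if_neg h0C] at h
      exact one_ne_zero h
    exact Finset.disjoint_left.1 hdisj (key 𝒜 E₁ h𝒜E hSA hA) (key ℬ E₂ hℬE hSB hB)
  rw [hz, zero_mul]
  exact mul_nonneg (hsum0 _) (hsum0 _)

/-- **The Zero–One Lemma, conditional and reweighted form**: a nonnegative weight supported on sets of
cardinality `≤ 1` is CNA+ (conditionings, external fields and projections keep the support condition).
[cite: DubhashiRanjan1998, §2.2 Lemma 8; Pemantle2000, §2.2 (CNA+)] -/
theorem isCNAPlus_of_card_le_one {μ : Finset σ → ℝ} (h0 : ∀ S, 0 ≤ μ S) (h1 : ∀ S, μ S ≠ 0 → S.card ≤ 1) :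
    IsCNAPlus μ := by
  intro a ha R I O
  refine isNegAssoc_of_card_le_one (pin_nonneg (projectOn_nonneg (extField_nonneg h0 ha) R) I O) fun T hT => ?_
  rw [pin_apply] at hT
  split_ifs at hT with h
  · rw [projectOn_apply] at hT
    obtain ⟨U, -, hU⟩ := Finset.exists_ne_zero_of_sum_ne_zero hT
    have hUR : U ∩ R = T := by
      by_contra hne
      rw [if_neg hne] at hU
      exact hU rfl
    rw [if_pos hUR, extField_apply] at hU
    have hμU : μ U ≠ 0 := left_ne_zero_of_mul hU
    rw [← hUR]
    exact (Finset.card_le_card Finset.inter_subset_left).trans (h1 U hμU)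
  · exact absurd rfl hT

/-- **Dubhashi–Ranjan, Lemma 8 as printed**: if exactly one `X_i = 1` (the weight lives on singletons), then the
`X_i` are NA; together with its CNA form. [cite: DubhashiRanjan1998, §2.2 Lemma 8] -/
theorem DubhashiRanjan_lemma_8 {μ : Finset σ → ℝ} (h0 : ∀ S, 0 ≤ μ S) (h1 : ∀ S, μ S ≠ 0 → S.card = 1) :
    IsNegAssoc μ ∧ IsCNA μ :=
  have h := isCNAPlus_of_card_le_one h0 fun S hS => (h1 S hS).le
  ⟨h.isCNA.isNegAssoc, h.isCNA⟩

end ZeroOne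

end Literature.Probability.NegativeDependence

end
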